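import Summits.ValiantsHypothesis.ValiantsHypothesis.Theorems.LacunarySymmetroidMatrixDescartesChainInertia
import Summits.ValiantsHypothesis.ValiantsHypothesis.Theorems.LacunarySymmetroidMatrixDescartesKThreeColumnLawHolds

/-!
# `MatrixDescartes` census — THE CAPPED LADDER: `ζ_sym(m, 3j+6) ≥ (j+1)(m² + 2m) + (m² + 3m)/2` for every `m`

HONEST FRAMING.  Object-search cell `pub-symmetroid`, crux `Theses.LacunarySymmetroid.MatrixDescartes`
(stmt-ValiantsHypothesis-18050); seat val-sym-mdr-p1 (g8).  LOWER-bound / construction mathematics in census (CONJECTURE-A)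
currency; it proves NOTHING about the crux `MatrixDescartes` (an UPPER-bound statement at fat formats), nothing about
`DoorA26` / `DoorA34`, nothing about `VP ≠ VNP`.  No definitions.

An ALL-`m` MIXED CHAIN by matching junction inertia (`Chain.exists_congr_of_diagonal`, `…ChainInertia.lean`).  The seat's two all-`m` bases
share one diagonal end letter up to positive rescaling: the `K = 3` arrowhead tower (`LagrangeTower.witnessLetters m D₃`, `C(m+2,2) − 1 =
(m² + 3m)/2` alternations, g2) has TOP letter `flagLetter m D₃ = diagonal (sgn a · (thr a)^{−D₃})`, and the two-sided `K = 4` tower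
(`witness4Letters m D₄`, `(m+1)² − 1 = m² + 2m` alternations) has TOP letter `upLetter m D₄ = diagonal (sgn a · (thr a)^{−(D₄+1)})` — the same
signs `sgn a ≠ 0` (`LagrangeTower.sgn_ne_zero`).  So the `K = 3` certificate chains onto the REVERSED `K = 4` ladder `B_j`
(`Chain.exists_alternating_ladder`, bottom letter `upLetter m D₄`): **`ζ_sym(m, 3(j+2)) ≥ (j+1)(m² + 2m) + (m² + 3m)/2`** for every `m ≥ 1`,
`j ≥ 0` (`not_posRootLawAt_towerMix`) — at `K ≡ 0 (mod 3)` this beats the pure ladder `⌊(K−1)/3⌋(m²+2m) + 2m` by `(m² − m)/2`: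
`ζ_sym(m,6) ≥ (3m² + 7m)/2`, `ζ_sym(m,9) ≥ (5m² + 11m)/2`, `ζ_sym(m,12) ≥ (7m² + 15m)/2`.  The bases are re-derived here with the
lacunarity `D` large enough for a strictly increasing support (`exists_alternating_three_explicit`, `exists_alternating_four_explicit`;
the tree's `exists_D_alternating` / `exists_D_alternating4` do not record `D ≥ 2` / `D ≥ 1`).  [folklore]
-/

-- `Summit.ValiantsHypothesis.ValiantsHypothesis.…` repeats a component by the D-0017 layout
-- (single-conjunct summit), which the `dupNamespace` linter flags; the name is mandated.
set_option linter.dupNamespace false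

namespace Summit.ValiantsHypothesis.ValiantsHypothesis.Theorems.LacunarySymmetroidMatrixDescartes.Census.Chain

open Matrix Finset Filter Topology
open scoped BigOperators
open Summit.ValiantsHypothesis.ValiantsHypothesis.Theorems.LacunarySymmetroidMatrixDescartes.Census.Graft
open Summit.ValiantsHypothesis.ValiantsHypothesis.Theorems.LacunarySymmetroidMatrixDescartes.Census.LagrangeTower
open Summit.ValiantsHypothesis.ValiantsHypothesis.Theorems.MatrixDescartes.Negative (PosRootLawAt)

/-! ### The junction law for matching junction inertia, plain form -/

/-- **Junction for matching junction inertia, plain certificate form** (as `Chain.exists_alternating_junction_inertia`, without the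
top-letter bookkeeping and without `K₂ ≥ 1`). [folklore] -/
theorem exists_alternating_junction_inertia' {m K₁ K₂ N₁ N₂ : ℕ}
    (d : Fin (K₁ + 1) → ℕ) (S : Fin (K₁ + 1) → Matrix (Fin m) (Fin m) ℝ) (hd : StrictMono d)
    (hS : ∀ l, (S l).IsSymm) (τ : Fin (N₁ + 1) → ℝ) (hτ : StrictMono τ) (hτpos : ∀ j, 0 < τ j)
    (hne : ∀ j, (∑ l, τ j ^ d l • S l).det ≠ 0)
    (halt : ∀ j : Fin N₁, (∑ l, τ j.castSucc ^ d l • S l).det * (∑ l, τ j.succ ^ d l • S l).det < 0)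
    (e : Fin (K₂ + 1) → ℕ) (T : Fin (K₂ + 1) → Matrix (Fin m) (Fin m) ℝ) (he : StrictMono e)
    (hT : ∀ l, (T l).IsSymm) (σ : Fin (N₂ + 1) → ℝ) (hσ : StrictMono σ) (hσpos : ∀ j, 0 < σ j)
    (hne' : ∀ j, (∑ l, σ j ^ e l • T l).det ≠ 0)
    (halt' : ∀ j : Fin N₂, (∑ l, σ j.castSucc ^ e l • T l).det * (∑ l, σ j.succ ^ e l • T l).det < 0)
    {p q : Fin m → ℝ}
    (hp : ∃ C : Matrix (Fin m) (Fin m) ℝ, C.det ≠ 0 ∧ Cᵀ * S (Fin.last K₁) * C = diagonal p)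
    (hq : ∃ C : Matrix (Fin m) (Fin m) ℝ, C.det ≠ 0 ∧ Cᵀ * T 0 * C = diagonal q)
    (π : Equiv.Perm (Fin m)) (hpq : ∀ i, 0 < p i * q (π i)) :
    ∃ (d' : Fin (K₁ + 1 + K₂) → ℕ) (S' : Fin (K₁ + 1 + K₂) → Matrix (Fin m) (Fin m) ℝ)
      (τ' : Fin (N₁ + N₂ + 1) → ℝ),
      (∀ l, (S' l).IsSymm) ∧ StrictMono τ' ∧ (∀ j, 0 < τ' j) ∧
      (∀ j, (∑ l, τ' j ^ d' l • S' l).det ≠ 0) ∧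
      ∀ j : Fin (N₁ + N₂), (∑ l, τ' j.castSucc ^ d' l • S' l).det * (∑ l, τ' j.succ ^ d' l • S' l).det < 0 := by
  obtain ⟨E, hE, hET⟩ := exists_congr_of_diagonal hp hq π hpq
  obtain ⟨hT₁, hne₁, halt₁⟩ := alternating_congr e T hT E hE σ hne' halt'
  obtain ⟨d', S', τ', -, -, -, hS', hτ', hpos', hne'', halt''⟩ :=
    exists_alternating_junction d S hd hS τ hτ hτpos hne halt e (fun l => Eᵀ * T l * E) he hT₁ σ hσ hσpos
      hne₁ halt₁ hET
  exact ⟨d', S', τ', hS', hτ', hpos', hne'', halt''⟩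

/-! ### The two all-`m` bases with a strictly increasing support -/

/-- **The `K = 3` base, explicit letters** (`LagrangeTower.witnessLetters m D` on the support `(0, 1, D)` with `D ≥ 2`): `tri (m+1) − 1`
alternations along the test points `pts m`. [folklore] -/
theorem exists_alternating_three_explicit (m : ℕ) (hm : 1 ≤ m) :
    ∃ D : ℕ, 2 ≤ D ∧ ∃ τ : Fin (tri (m + 1) - 1 + 1) → ℝ, StrictMono τ ∧ (∀ i, 0 < τ i) ∧
      (∀ i, (∑ l, τ i ^ witnessExps D l • witnessLetters m D l).det ≠ 0) ∧
      ∀ i : Fin (tri (m + 1) - 1), (∑ l, τ i.castSucc ^ witnessExps D l • witnessLetters m D l).det *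
        (∑ l, τ i.succ ^ witnessExps D l • witnessLetters m D l).det < 0 := by
  set N := tri (m + 1) - 1 with hN
  have htri2 : 2 ≤ tri (m + 1) := by
    rw [show tri (m + 1) = tri m + (m + 1) from rfl]
    have : 1 ≤ tri m := by
      obtain ⟨m', rfl⟩ : ∃ m', m = m' + 1 := ⟨m - 1, by omega⟩
      rw [show tri (m' + 1) = tri m' + (m' + 1) from rfl]; omega
    omega
  have hall : ∀ᶠ D : ℕ in atTop, ∀ n : Fin N,
      Matrix.det ((tower m).A + pts m n • (tower m).B + diagonal (fun a : Fin m => sgn a * (pts m n / thr a) ^ D)) *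
        Matrix.det ((tower m).A + pts m (n + 1) • (tower m).B +
          diagonal (fun a : Fin m => sgn a * (pts m (n + 1) / thr a) ^ D)) < 0 := by
    refine eventually_all.mpr fun n => ?_
    have ha := eventually_sign_at m n (by omega)
    have hb := eventually_sign_at m (n + 1) (by omega)
    have hE := Ewalk_mul_succ_neg m n n.isLt
    filter_upwards [ha, hb] with D hDa hDb
    exact mul_neg_of_carriers hDa hDb hE
  obtain ⟨D, hD, hD2⟩ := (hall.and (eventually_ge_atTop 2)).exists
  have heval : ∀ t : ℝ, (∑ l, t ^ witnessExps D l • witnessLetters m D l).det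
      = Matrix.det ((tower m).A + t • (tower m).B + diagonal (fun a : Fin m => sgn a * (t / thr a) ^ D)) := fun t => by
    rw [← eval_det_pencil_eq, eval_det_witness]
  have halt : ∀ i : Fin N, (∑ l, pts m (Fin.castSucc i) ^ witnessExps D l • witnessLetters m D l).det *
      (∑ l, pts m i.succ ^ witnessExps D l • witnessLetters m D l).det < 0 := fun i => by
    rw [heval, heval, Fin.val_castSucc, Fin.val_succ]
    exact hD i
  refine ⟨D, hD2, fun i => pts m i, ?_, fun i => pts_pos m i,
    ne_zero_of_alternating (by omega) (fun i => (∑ l, pts m i ^ witnessExps D l • witnessLetters m D l).det) halt, halt⟩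
  refine Fin.strictMono_iff_lt_succ.mpr fun i => ?_
  rw [Fin.val_castSucc, Fin.val_succ]
  exact pts_lt_succ m i (by omega)

/-- **The `K = 4` base, explicit letters** (`LagrangeTower.witness4Letters m D` on the support `(0, D, D+1, 2D+1)` with `D ≥ 1`):
`tri m + tri (m+1) − 1 = m² + 2m` alternations along the test points `cpts m`. [folklore] -/
theorem exists_alternating_four_explicit (m : ℕ) (hm : 1 ≤ m) :
    ∃ D : ℕ, 1 ≤ D ∧ ∃ τ : Fin (tri m + tri (m + 1) - 1 + 1) → ℝ, StrictMono τ ∧ (∀ i, 0 < τ i) ∧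
      (∀ i, (∑ l, τ i ^ witness4Exps D l • witness4Letters m D l).det ≠ 0) ∧
      ∀ i : Fin (tri m + tri (m + 1) - 1), (∑ l, τ i.castSucc ^ witness4Exps D l • witness4Letters m D l).det *
        (∑ l, τ i.succ ^ witness4Exps D l • witness4Letters m D l).det < 0 := by
  set N := tri m + tri (m + 1) - 1 with hN
  have hsq := tri_add_tri_succ m
  have hN2 : 2 ≤ tri m + tri (m + 1) := by rw [hsq]; nlinarith
  have hall : ∀ᶠ D : ℕ in atTop, ∀ n : Fin N,
      Matrix.det (Gmat m D (cpts m n)) * Matrix.det (Gmat m D (cpts m (n + 1))) < 0 := by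
    refine eventually_all.mpr fun n => ?_
    have ha := eventually_sign_comb m n (by omega)
    have hb := eventually_sign_comb m (n + 1) (by omega)
    have hE := Ecomb_mul_succ_neg m n hm (by omega)
    filter_upwards [ha, hb] with D hDa hDb
    exact mul_neg_of_carriers hDa hDb hE
  obtain ⟨D, hD, hD1⟩ := (hall.and (eventually_ge_atTop 1)).exists
  have heval : ∀ t : ℝ, 0 < t →
      (∑ l, t ^ witness4Exps D l • witness4Letters m D l).det = (t ^ D) ^ m * (Gmat m D t).det := by
    intro t ht
    rw [pencil4_eq_smul_Gmat m D ht.ne', Matrix.det_smul, Fintype.card_fin]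
  have halt : ∀ i : Fin N, (∑ l, cpts m (Fin.castSucc i) ^ witness4Exps D l • witness4Letters m D l).det *
      (∑ l, cpts m i.succ ^ witness4Exps D l • witness4Letters m D l).det < 0 := by
    intro i
    rw [Fin.val_castSucc, Fin.val_succ, heval _ (cpts_pos m i), heval _ (cpts_pos m (i + 1))]
    have h1 : 0 < (cpts m i ^ D) ^ m := by have := cpts_pos m i; positivity
    have h2 : 0 < (cpts m (i + 1) ^ D) ^ m := by have := cpts_pos m (i + 1); positivity
    have hrw : (cpts m ↑i ^ D) ^ m * (Gmat m D (cpts m ↑i)).det *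
        ((cpts m (↑i + 1) ^ D) ^ m * (Gmat m D (cpts m (↑i + 1))).det)
        = ((cpts m ↑i ^ D) ^ m * (cpts m (↑i + 1) ^ D) ^ m) *
          ((Gmat m D (cpts m ↑i)).det * (Gmat m D (cpts m (↑i + 1))).det) := by ring
    rw [hrw]
    exact mul_neg_of_pos_of_neg (mul_pos h1 h2) (hD i)
  refine ⟨D, hD1, fun i => cpts m i, ?_, fun i => cpts_pos m i,
    ne_zero_of_alternating (by omega) (fun i => (∑ l, cpts m i ^ witness4Exps D l • witness4Letters m D l).det) halt,
    halt⟩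
  refine Fin.strictMono_iff_lt_succ.mpr fun i => ?_
  rw [Fin.val_castSucc, Fin.val_succ]
  exact cpts_lt_succ m i hm (by omega)

/-- The `K = 3` support `(0, 1, D)` is strictly increasing for `D ≥ 2`. [folklore] -/
theorem strictMono_witnessExps {D : ℕ} (hD : 2 ≤ D) : StrictMono (witnessExps D) := by
  refine Fin.strictMono_iff_lt_succ.mpr fun i => ?_
  fin_cases i
  · show (witnessExps D) 0 < (witnessExps D) 1
    simp [witnessExps]
  · show (witnessExps D) 1 < (witnessExps D) 2
    simp [witnessExps]; omega

/-- The `K = 4` support `(0, D, D+1, 2D+1)` is strictly increasing for `D ≥ 1`. [folklore] -/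
theorem strictMono_witness4Exps {D : ℕ} (hD : 1 ≤ D) : StrictMono (witness4Exps D) := by
  refine Fin.strictMono_iff_lt_succ.mpr fun i => ?_
  fin_cases i
  · show (witness4Exps D) 0 < (witness4Exps D) 1
    simp [witness4Exps]; omega
  · show (witness4Exps D) 1 < (witness4Exps D) 2
    simp [witness4Exps]
  · show (witness4Exps D) 2 < (witness4Exps D) 3
    simp [witness4Exps]; omega

/-! ### The capped ladder -/

/-- **THE CAPPED LADDER: `ζ_sym(m, 3(j+2)) ≥ (j+1)(m² + 2m) + (m² + 3m)/2` for every `m ≥ 1`, `j ≥ 0`** —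
`¬ PosRootLawAt m (3(j+2)) ((j+1)((m+1)² − 1) + (C(m+2,2) − 1) − 1)`: the `K = 3` arrowhead tower (top letter `flagLetter m D₃`, signs
`sgn a`) chained by MATCHING JUNCTION INERTIA onto the reversed `K = 4` ladder `B_j` (bottom letter `upLetter m D₄`, the same signs
`sgn a`).  Instances: `ζ_sym(m,6) ≥ (3m²+7m)/2`, `ζ_sym(m,9) ≥ (5m²+11m)/2`, `ζ_sym(m,12) ≥ (7m²+15m)/2`.  A LOWER bound in census
currency — nothing about the crux `MatrixDescartes`. [folklore] -/
theorem not_posRootLawAt_towerMix (m j : ℕ) (hm : 1 ≤ m) :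
    ¬ PosRootLawAt m (3 * (j + 2)) ((j + 1) * ((m + 1) ^ 2 - 1) + (Nat.choose (m + 2) 2 - 1) - 1) := by
  classical
  -- the two bases
  obtain ⟨D₃, hD₃, τ₃, hτ₃, hpos₃, hne₃, halt₃⟩ := exists_alternating_three_explicit m hm
  obtain ⟨D₄, hD₄, τ₄, hτ₄, hpos₄, hne₄, halt₄⟩ := exists_alternating_four_explicit m hm
  have hd₃ := strictMono_witnessExps hD₃
  have hd₄ := strictMono_witness4Exps hD₄
  -- the reversed `K = 4` ladder `B_j`: bottom letter `upLetter m D₄`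
  obtain ⟨-, ⟨e, T, σ, he, hT0, hT, hσ, hσpos, hne', halt'⟩⟩ :=
    exists_alternating_ladder (witness4Exps D₄) (witness4Letters m D₄) hd₄ (witness4Letters_isSymm m D₄) τ₄ hτ₄ hpos₄
      hne₄ halt₄ j
  -- the junction letters are diagonal with the same signs `sgn a`
  have hTop3 : witnessLetters m D₃ (Fin.last 2) = diagonal (fun a : Fin m => sgn a * ((thr a)⁻¹) ^ D₃) := rfl
  have hBot : T 0 = diagonal (fun a : Fin m => sgn a * ((thr a)⁻¹) ^ (D₄ + 1)) := hT0 (Nat.succ_pos _)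
  have hp : ∃ C : Matrix (Fin m) (Fin m) ℝ, C.det ≠ 0 ∧
      Cᵀ * witnessLetters m D₃ (Fin.last 2) * C = diagonal (fun a : Fin m => sgn a * ((thr a)⁻¹) ^ D₃) :=
    ⟨1, by simp, by rw [hTop3, transpose_one, Matrix.one_mul, Matrix.mul_one]⟩
  have hq : ∃ C : Matrix (Fin m) (Fin m) ℝ, C.det ≠ 0 ∧
      Cᵀ * T 0 * C = diagonal (fun a : Fin m => sgn a * ((thr a)⁻¹) ^ (D₄ + 1)) :=
    ⟨1, by simp, by rw [hBot, transpose_one, Matrix.one_mul, Matrix.mul_one]⟩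
  have hpq : ∀ a : Fin m, 0 < (sgn a * ((thr a)⁻¹) ^ D₃) * (sgn a * ((thr a)⁻¹) ^ (D₄ + 1)) := by
    intro a
    have h1 : 0 < sgn a * sgn a := mul_self_pos.mpr (sgn_ne_zero a)
    have h2 : 0 < ((thr a)⁻¹) ^ D₃ * ((thr a)⁻¹) ^ (D₄ + 1) := by
      have := inv_pos.mpr (thr_pos a); positivity
    have hrw : (sgn a * ((thr a)⁻¹) ^ D₃) * (sgn a * ((thr a)⁻¹) ^ (D₄ + 1))
        = (sgn a * sgn a) * (((thr a)⁻¹) ^ D₃ * ((thr a)⁻¹) ^ (D₄ + 1)) := by ring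
    rw [hrw]
    exact mul_pos h1 h2
  -- chain and read off the row
  obtain ⟨d', S', τ', hS', hτ', hpos', -, halt''⟩ :=
    exists_alternating_junction_inertia' (witnessExps D₃) (witnessLetters m D₃) hd₃ (witnessLetters_isSymm m D₃) τ₃ hτ₃
      hpos₃ hne₃ halt₃ e T he hT σ hσ hσpos hne' halt' hp hq (Equiv.refl _) (fun a => by rw [Equiv.refl_apply]; exact hpq a)
  have htri : tri (m + 1) = Nat.choose (m + 2) 2 := tri_eq_choose (m + 1)
  have hsq := tri_add_tri_succ m
  have htri2 : 2 ≤ tri (m + 1) := by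
    rw [show tri (m + 1) = tri m + (m + 1) from rfl]
    have : 1 ≤ tri m := by
      obtain ⟨m', rfl⟩ : ∃ m', m = m' + 1 := ⟨m - 1, by omega⟩
      rw [show tri (m' + 1) = tri m' + (m' + 1) from rfl]; omega
    omega
  have hN : 1 ≤ tri (m + 1) - 1 + (j + 1) * (tri m + tri (m + 1) - 1) := by omega
  have h := not_posRootLawAt_of_alternating hN d' S' hS' τ' hτ' hpos' halt''
  rw [show 2 + 1 + (j + 1) * 3 = 3 * (j + 2) by ring] at h
  have hB : tri (m + 1) - 1 + (j + 1) * (tri m + tri (m + 1) - 1) - 1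
      = (j + 1) * ((m + 1) ^ 2 - 1) + (Nat.choose (m + 2) 2 - 1) - 1 := by
    rw [hsq, ← htri]
    generalize (j + 1) * ((m + 1) ^ 2 - 1) = b
    omega
  rw [hB] at h
  exact h

/-- **`ζ_sym(m,6) ≥ (3m² + 7m)/2` for every `m ≥ 1`** — `¬ PosRootLawAt m 6 ((m+1)² − 1 + (C(m+2,2) − 1) − 1)`
(graft / ladder floor: `m² + 4m`). [folklore] -/
theorem not_posRootLawAt_six_mix (m : ℕ) (hm : 1 ≤ m) :
    ¬ PosRootLawAt m 6 (((m + 1) ^ 2 - 1) + (Nat.choose (m + 2) 2 - 1) - 1) := by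
  have h := not_posRootLawAt_towerMix m 0 hm
  rw [show 3 * (0 + 2) = 6 by norm_num, zero_add, one_mul] at h
  exact h

/-! ### Numeral rows (census format `(m,K) ≥ B + 1` reads `¬ PosRootLawAt m K B`) -/

/-- `ζ_sym(4,6) ≥ 38` (graft ray of record: `36`). [folklore] -/
theorem row_4_6 : ¬ PosRootLawAt 4 6 37 := by
  have h := not_posRootLawAt_towerMix 4 0 (by norm_num); norm_num [Nat.choose] at h; exact h

/-- `ζ_sym(5,6) ≥ 55` (graft ray of record: `47`). [folklore] -/
theorem row_5_6 : ¬ PosRootLawAt 5 6 54 := by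
  have h := not_posRootLawAt_towerMix 5 0 (by norm_num); norm_num [Nat.choose] at h; exact h

/-- `ζ_sym(6,6) ≥ 75` (graft floor: `60`). [folklore] -/
theorem row_6_6_mix : ¬ PosRootLawAt 6 6 74 := by
  have h := not_posRootLawAt_towerMix 6 0 (by norm_num); norm_num [Nat.choose] at h; exact h

/-- `ζ_sym(5,9) ≥ 90` (chained census ray: `84`). [folklore] -/
theorem row_5_9 : ¬ PosRootLawAt 5 9 89 := by
  have h := not_posRootLawAt_towerMix 5 1 (by norm_num); norm_num [Nat.choose] at h; exact h

/-- `ζ_sym(6,9) ≥ 123` (ladder + grafts: `108`). [folklore] -/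
theorem row_6_9 : ¬ PosRootLawAt 6 9 122 := by
  have h := not_posRootLawAt_towerMix 6 1 (by norm_num); norm_num [Nat.choose] at h; exact h

/-- `ζ_sym(6,12) ≥ 171` (ladder + grafts: `156`). [folklore] -/
theorem row_6_12 : ¬ PosRootLawAt 6 12 170 := by
  have h := not_posRootLawAt_towerMix 6 2 (by norm_num); norm_num [Nat.choose] at h; exact h

/-- `ζ_sym(8,6) ≥ 124` (graft floor: `96`). [folklore] -/
theorem row_8_6 : ¬ PosRootLawAt 8 6 123 := by
  have h := not_posRootLawAt_towerMix 8 0 (by norm_num); norm_num [Nat.choose] at h; exact h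

end Summit.ValiantsHypothesis.ValiantsHypothesis.Theorems.LacunarySymmetroidMatrixDescartes.Census.Chain
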